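import Literature.Geometry.Kaehler.ComplexTorusAnalyticBezoutInequality
import Literature.Geometry.Kaehler.ComplexTorusAnalyticIteratedIntersectionProperComponents
import HarnessLib

/-!
# Proper components of the intersection of two closed analytic subsets of a complex torus: they are
# components of the intersection cycle with positive multiplicity; refined Bézout amid excess components;
# equality in Bézout

Layer `Literature/Geometry/Kaehler`; lane `lit-hodgefound`, seat p07, programme «INTERSECTION NUMBERS ARE
POINT COUNTS», file 21 — the two-subvariety companion (arbitrary dimensions `d₁, d₂`, expected dimension
`q + 1 = d₁ + d₂ − g ≥ 1`) of files 19–20 (a subvariety and `k` hypersurfaces). Let `Y₁, Y₂ ⊆ X = E/Λ` be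
closed analytic of pure dimensions `d₁, d₂`. `ComplexTorusAnalyticIntersectionCycle` §7 represents
`[Y₁]_e ∧ [Y₂]_e = sign(e) · cl_e(S)` by an EFFECTIVE `(q+1)`-cycle `S` on `Y₁ ∩ Y₂` whose support contains every
proper point of `Y₁ ∩ Y₂` (Fulton's dynamic intersection cycle, Cor. 12.2 (a) on an abelian variety); §6 there
and `ComplexTorusAnalyticBezoutInequality` treat PROPER intersections (`Y₁ ∩ Y₂` of pure dimension `q + 1`).
Here excess components are allowed:

* §0 `support_eq_empty_or_hasPureDim` — the support of an analytic `p`-cycle of the torus is empty or of pure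
  dimension `p`;
* §1 **`exists_effectiveCycle_wedge_analyticCycleClass_eq_forall_one_le_mult`** — every PROPER COMPONENT `C`
  of `Y₁ ∩ Y₂` (irreducible component of dimension `q + 1`, [Fulton1998, Def. 7.1]) is an irreducible
  component of `|S|` with multiplicity `S.mult C ≥ 1` ("`1 ≤ i(Z, X·V; Y)`", Prop. 7.1 (a); "each irreducible
  component of `⋂ V_i` appears as a distinguished variety", §12.2);
* §2 refined Bézout amid excess components [Fulton1998, Example 8.4.6]: for `θ` pairing non-negatively with
  the `(q+1)`-dimensional subvarieties `Σ_{C proper} Re ⟨θ, [C]⟩ ≤ Re ⟨θ, sign(e)·[Y₁] ∧ [Y₂]⟩`; polarised by a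
  Riemann form `η` (`c₁(L) = ofRealForm(−η)`): `(L^{q+1} · Y₁ · Y₂) ∈ ℕ`, `Σ_{C proper} (L^{q+1} · C) ≤ (L^{q+1} · Y₁ · Y₂)`
  and **`#{proper components of Y₁ ∩ Y₂} ≤ (L^{q+1} · Y₁ · Y₂)`**;
* §3 equality [Fulton1998, §8.4 (1), Prop. 8.2 (c)]: if `(L^{q+1} · Y₁ · Y₂) ≤ #{proper components}` then the
  components of `S` are exactly the proper components, all of multiplicity one and `L`-degree one, and
  `sign(e)·[Y₁] ∧ [Y₂] = Σ_{C proper} [C]`; for a proper intersection, `sign(e)·[Y₁]_e ∧ [Y₂]_e = [Y₁ ∩ Y₂]_e`.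

> [Fulton1998, §7.1 Def. 7.1, Prop. 7.1 (a) (p. 119–120); §8.2 Prop. 8.2 (p. 137–138); §8.4 (1) (p. 145),
> Example 8.4.6 (p. 148); §12.2 Cor. 12.2 (a) and Example 12.2.1 (a) (p. 212–213)];
> [Chirka1989, §5.3 Cor. 2 (p. 55), §5.4 Thm. (p. 57), §11.5 (p. 130), §16.1 Prop. 1 (p. 206)].

Theorems only; no definitions, no named facts.

## References

* [Fulton1998] W. Fulton, *Intersection Theory*, 2nd ed., Springer 1998, §7.1, §8.2, §8.4, §12.2.
* [Chirka1989] E. M. Chirka, *Complex Analytic Sets*, Kluwer 1989, §5.3–5.4, §11.5, §16.1.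
* [deJong1993AmpleLineBundles] J. de Jong (ed.), *Ample line bundles and intersection theory*, in:
  Diophantine Approximation and Abelian Varieties, LNM 1566, Springer 1993, Ch. VII §4 Remarks 4.3 and
  Thm. 4.3.1.
* [VoisinHodgeI2002] C. Voisin, *Hodge Theory and Complex Algebraic Geometry I*, CUP 2002, §11.1.2.
-/

noncomputable section

open scoped Manifold Topology Pointwise
open MeasureTheory Set Function Filter Module
open Literature.LinearAlgebra.Alternating

namespace Literature.Geometry.Kaehler

-- Nested operator-norm instances on `V [⋀^Fin m]→L[ℝ] F`, as in `ComplexTorusAnalyticIntersectionCycle`.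
set_option maxSynthPendingDepth 2

namespace ComplexTorus

universe u

variable {ι : Type*} [Fintype ι] [DecidableEq ι] {E : Type u} [NormedAddCommGroup E] [InnerProductSpace ℂ E]
  [FiniteDimensional ℂ E] [MeasurableSpace E] [BorelSpace E] (Φ : (ι → ℝ) ≃L[ℝ] E) {n : ℕ} (e : Fin n ≃ ι)
  {d₁ d₂ p₁ p₂ q : ℕ}

/-! ### §0 The support of an analytic cycle of the torus is empty or pure-dimensional -/

omit [DecidableEq ι] [MeasurableSpace E] [BorelSpace E] in
/-- **The support `|T| = ⋃_{k_W ≠ 0} W` of an analytic `p`-cycle of the torus is empty or of pure dimension `p`**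
(a finite union of irreducible analytic sets of pure dimension `p`). [cite: Chirka1989, §11.5 Def., p. 130; §5.3 Cor. 2, p. 55] -/
theorem support_eq_empty_or_hasPureDim {p : ℕ} (T : HolomorphicChain 𝓘(ℂ, E) (ComplexTorus Φ) p) :
    T.support = ∅ ∨ HasPureDim 𝓘(ℂ, E) T.support p := by
  classical
  rw [HolomorphicChain.support_eq_biUnion_toFinset]
  have key : ∀ F : Finset (Set (ComplexTorus Φ)), (∀ W ∈ F, HasPureDim 𝓘(ℂ, E) W p) →
      (⋃ W ∈ F, W) = ∅ ∨ HasPureDim 𝓘(ℂ, E) (⋃ W ∈ F, W) p := by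
    intro F hF
    induction F using Finset.induction_on with
    | empty => exact Or.inl (by simp)
    | insert W F hW ih =>
      rw [Finset.set_biUnion_insert]
      have hWp := hF W (Finset.mem_insert_self W F)
      rcases ih (fun W' hW' ↦ hF W' (Finset.mem_insert_of_mem hW')) with h0 | hp
      · rw [h0, union_empty]
        exact Or.inr hWp
      · exact Or.inr (hWp.union hp)
  exact key _ fun W hW ↦ T.hasPureDim_of_mult_ne_zero (T.finite_components_of_compactSpace.mem_toFinset.1 hW)

/-! ### §1 Proper components of `Y₁ ∩ Y₂` are components of the intersection cycle, with positive multiplicity -/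

omit [DecidableEq ι] [MeasurableSpace E] [BorelSpace E] in
/-- On an open `V` where `Z` coincides with a pure `(q+1)`-dimensional analytic `W`, every point of `Z ∩ V` is
a proper point of `Z`. [cite: Chirka1989, §12.1, p. 136] -/
private theorem eventually_finrank_le_of_inter_eq_inter₂₁ {Z V W : Set (ComplexTorus Φ)} (hV : IsOpen V)
    (hW : HasPureDim 𝓘(ℂ, E) W (q + 1)) (hZW : Z ∩ V = W ∩ V) {z : ComplexTorus Φ} (hzV : z ∈ V) :
    ∀ᶠ x in 𝓝 z, x ∈ Z → ∀ c, IsRegularPointOfCodim 𝓘(ℂ, E) Z c x → finrank ℂ E ≤ c + (q + 1) := by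
  obtain ⟨c₀, hc₀, -, -, hreg⟩ := hW
  filter_upwards [hV.mem_nhds hzV] with x hxV hxZ c hc
  have hxW : x ∈ W := (hZW.subset ⟨hxZ, hxV⟩).1
  have hcW : IsRegularPointOfCodim 𝓘(ℂ, E) W c x := hc.congr_set hV hxV hZW
  have h := (hreg x ⟨hxW, c, hcW⟩).codim_unique hxW hcW
  omega

/-- **PROPER COMPONENTS OF `Y₁ ∩ Y₂` ARE COMPONENTS OF THE INTERSECTION CYCLE, WITH POSITIVE MULTIPLICITY.**
For closed analytic `Y₁, Y₂ ⊆ X` of pure dimensions `d₁, d₂` with expected dimension `q + 1 = d₁ + d₂ − g ≥ 1`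
there is an EFFECTIVE analytic `(q+1)`-cycle `S` with `|S| ⊆ Y₁ ∩ Y₂`, `|S|` empty or of pure dimension `q + 1`,
`[Y₁]_e ∧ [Y₂]_e = sign(e) · cl_e(S)`, whose support contains every proper point of `Y₁ ∩ Y₂`, and such that
every PROPER COMPONENT `C` of `Y₁ ∩ Y₂` — an irreducible component of the expected dimension `q + 1` — is an
irreducible component of `|S|` with `S.mult C ≥ 1`: off the other components `Y₁ ∩ Y₂` coincides with `C` on a
non-empty open set (`exists_isOpen_nonempty_inter_subset_of_isIrreducibleComponent`), whose points are proper,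
hence on `|S|`; the irreducible `C` then lies in `|S|` and is a component of `S`. This is Fulton's
"`1 ≤ i(Z, X·V; Y)`" for the proper components `Z` (Prop. 7.1 (a)) inside the non-negative canonical
decomposition on an abelian variety (Cor. 12.2 (a): "each irreducible component of `⋂ V_i` appears as a
distinguished variety"). [cite: Fulton1998, §7.1 Prop. 7.1 (a) and §12.2 Cor. 12.2 (a), Example 12.2.1 (a)]
[cite: Chirka1989, §5.3 Cor. 2 (p. 55) and §16.1 Prop. 1 (p. 206)] -/
theorem exists_effectiveCycle_wedge_analyticCycleClass_eq_forall_one_le_mult (hk₁ : 2 * d₁ + 2 * p₁ = n)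
    (hk₂ : 2 * d₂ + 2 * p₂ = n) (hq : 2 * (q + 1) + 2 * (p₁ + p₂) = n) {Y₁ Y₂ : Set (ComplexTorus Φ)}
    (hY₁ : HasPureDim 𝓘(ℂ, E) Y₁ d₁) (hY₂ : HasPureDim 𝓘(ℂ, E) Y₂ d₂) :
    ∃ S : HolomorphicChain 𝓘(ℂ, E) (ComplexTorus Φ) (q + 1),
      (∀ W, 0 ≤ S.mult W) ∧ S.support ⊆ Y₁ ∩ Y₂ ∧ (S.support = ∅ ∨ HasPureDim 𝓘(ℂ, E) S.support (q + 1)) ∧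
        (∀ z ∈ Y₁ ∩ Y₂, (∀ᶠ x in 𝓝 z, x ∈ Y₁ ∩ Y₂ → ∀ c, IsRegularPointOfCodim 𝓘(ℂ, E) (Y₁ ∩ Y₂) c x →
          finrank ℂ E ≤ c + (q + 1)) → z ∈ S.support) ∧
        (∀ C, IsIrreducibleComponent 𝓘(ℂ, E) (Y₁ ∩ Y₂) C → HasPureDim 𝓘(ℂ, E) C (q + 1) →
          IsIrreducibleComponent 𝓘(ℂ, E) S.support C ∧ 1 ≤ S.mult C) ∧
        ((analyticCycleClass Φ e hk₁ hY₁).wedge (analyticCycleClass Φ e hk₂ hY₂)).domDomCongr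
            (finCongr (by ring : 2 * p₁ + 2 * p₂ = 2 * (p₁ + p₂))) =
          (orientationSign Φ e : ℂ) • chainCycleClass Φ e hq S := by
  obtain ⟨S, hS0, hSs, hmem, hcl⟩ :=
    exists_effectiveCycle_wedge_analyticCycleClass_eq_support_supset Φ e hk₁ hk₂ hq hY₁ hY₂
  have hSpure := support_eq_empty_or_hasPureDim Φ S
  refine ⟨S, hS0, hSs, hSpure, hmem, fun C hC hCdim ↦ ?_, hcl⟩
  have hZan : IsAnalyticSet 𝓘(ℂ, E) (Y₁ ∩ Y₂) := hY₁.isAnalyticSet.inter hY₂.isAnalyticSet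
  -- off the other components, `Y₁ ∩ Y₂` is `C`
  obtain ⟨V, hVo, hCV, hZV⟩ := exists_isOpen_nonempty_inter_subset_of_isIrreducibleComponent Φ hZan hC
  have hZC : (Y₁ ∩ Y₂) ∩ V = C ∩ V :=
    Subset.antisymm (fun x hx ↦ ⟨hZV hx, hx.2⟩) fun x hx ↦ ⟨hC.subset hx.1, hx.2⟩
  -- so the points of `C ∩ V` are proper, hence on `|S|`
  have hCVS : C ∩ V ⊆ S.support := fun x hx ↦
    hmem x (hC.subset hx.1) (eventually_finrank_le_of_inter_eq_inter₂₁ Φ hVo hCdim hZC hx.2)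
  have hCS : C ⊆ S.support :=
    hC.isIrreducibleAnalyticSet.subset_of_isOpen_inter_subset S.isAnalyticSet_support hVo hCV hCVS
  exact isIrreducibleComponent_support_and_one_le_mult_of_subset Φ S hS0 hSpure hC.isIrreducibleAnalyticSet hCdim hCS

omit [DecidableEq ι] [MeasurableSpace E] [BorelSpace E] in
/-- The proper components of `Y₁ ∩ Y₂` form a finite set. [cite: Chirka1989, §5.4 Thm., p. 57] -/
theorem finite_setOf_isIrreducibleComponent_inter_and_hasPureDim {r : ℕ} {Y₁ Y₂ : Set (ComplexTorus Φ)}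
    (hY₁ : HasPureDim 𝓘(ℂ, E) Y₁ d₁) (hY₂ : HasPureDim 𝓘(ℂ, E) Y₂ d₂) :
    {C : Set (ComplexTorus Φ) | IsIrreducibleComponent 𝓘(ℂ, E) (Y₁ ∩ Y₂) C ∧ HasPureDim 𝓘(ℂ, E) C r}.Finite :=
  (finite_isIrreducibleComponent Φ (hY₁.isAnalyticSet.inter hY₂.isAnalyticSet)).subset fun _ h ↦ h.1

/-! ### §2 Refined Bézout for the proper components of `Y₁ ∩ Y₂` amid excess components -/

/-- **`Σ_{C proper} Re ⟨θ, [C]⟩ ≤ Re ⟨θ, sign(e) · [Y₁] ∧ [Y₂]⟩`** for every finite set `P` of proper components of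
`Y₁ ∩ Y₂` and every `2(q+1)`-form `θ` pairing non-negatively with the `(q+1)`-dimensional subvarieties: the
right-hand side is `Σ_W m_W Re ⟨θ, [W]⟩` over the components of the effective intersection cycle (§1;
`sign(e)² = 1`), the proper components are among them with `m_C ≥ 1`, and all terms are `≥ 0`.
[cite: Fulton1998, §7.1 Prop. 7.1 (a), §8.4 Example 8.4.6 and §12.2 Cor. 12.2 (a)] [cite: VoisinHodgeI2002, §11.1.2 Rem. 11.19] -/
theorem sum_re_poincarePairing_setCycleClass_le_smul_wedge_of_proper_components (hk₁ : 2 * d₁ + 2 * p₁ = n)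
    (hk₂ : 2 * d₂ + 2 * p₂ = n) (hq : 2 * (q + 1) + 2 * (p₁ + p₂) = n) {Y₁ Y₂ : Set (ComplexTorus Φ)}
    (hY₁ : HasPureDim 𝓘(ℂ, E) Y₁ d₁) (hY₂ : HasPureDim 𝓘(ℂ, E) Y₂ d₂) (P : Finset (Set (ComplexTorus Φ)))
    (hP : ∀ C ∈ P, IsIrreducibleComponent 𝓘(ℂ, E) (Y₁ ∩ Y₂) C ∧ HasPureDim 𝓘(ℂ, E) C (q + 1))
    (θ : E [⋀^Fin (2 * (q + 1))]→L[ℝ] ℂ)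
    (hθ : ∀ (W : Set (ComplexTorus Φ)), HasPureDim 𝓘(ℂ, E) W (q + 1) →
      0 ≤ (poincarePairing Φ e hq θ (setCycleClass Φ e hq W)).re) :
    ∑ C ∈ P, (poincarePairing Φ e hq θ (setCycleClass Φ e hq C)).re ≤
      (poincarePairing Φ e hq θ ((orientationSign Φ e : ℂ) •
        ((analyticCycleClass Φ e hk₁ hY₁).wedge (analyticCycleClass Φ e hk₂ hY₂)).domDomCongr
          (finCongr (by ring : 2 * p₁ + 2 * p₂ = 2 * (p₁ + p₂))))).re := by
  classical
  have hs : ((orientationSign Φ e : ℤ) : ℂ) * orientationSign Φ e = 1 := by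
    exact_mod_cast orientationSign_mul_self Φ e
  obtain ⟨S, hS0, -, -, -, hprop, hcl⟩ :=
    exists_effectiveCycle_wedge_analyticCycleClass_eq_forall_one_le_mult Φ e hk₁ hk₂ hq hY₁ hY₂
  rw [hcl, smul_smul, hs, one_smul, poincarePairing_chainCycleClass, Complex.re_sum]
  have key : ∀ (m : ℤ) (z : ℂ), ((m : ℂ) * z).re = (m : ℝ) * z.re := fun m z ↦ by
    rw [← Complex.ofReal_intCast, Complex.re_ofReal_mul]
  have hPsub : P ⊆ S.finite_components_of_compactSpace.toFinset := fun C hC ↦ by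
    rw [Set.Finite.mem_toFinset, HolomorphicChain.mem_components_iff]
    have h1 := (hprop C (hP C hC).1 (hP C hC).2).2
    omega
  have hθ' : ∀ W ∈ S.finite_components_of_compactSpace.toFinset,
      0 ≤ (poincarePairing Φ e hq θ (setCycleClass Φ e hq W)).re := fun W hW ↦
    hθ W (S.hasPureDim_of_mult_ne_zero (S.finite_components_of_compactSpace.mem_toFinset.1 hW))
  calc ∑ C ∈ P, (poincarePairing Φ e hq θ (setCycleClass Φ e hq C)).re
      ≤ ∑ C ∈ P, ((S.mult C : ℂ) * poincarePairing Φ e hq θ (setCycleClass Φ e hq C)).re := by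
        refine Finset.sum_le_sum fun C hC ↦ ?_
        rw [key]
        have h1 : (1 : ℝ) ≤ ((S.mult C : ℤ) : ℝ) := by exact_mod_cast (hprop C (hP C hC).1 (hP C hC).2).2
        have h0 := hθ' C (hPsub hC)
        nlinarith
    _ ≤ ∑ W ∈ S.finite_components_of_compactSpace.toFinset,
          ((S.mult W : ℂ) * poincarePairing Φ e hq θ (setCycleClass Φ e hq W)).re :=
        Finset.sum_le_sum_of_subset_of_nonneg hPsub fun W hW _ ↦ by
          rw [key]
          exact mul_nonneg (by exact_mod_cast hS0 W) (hθ' W hW)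

/-- **One proper component: `Re ⟨θ, [C]⟩ ≤ Re ⟨θ, sign(e) · [Y₁] ∧ [Y₂]⟩`** for `θ` pairing non-negatively with the
`(q+1)`-dimensional subvarieties. [cite: Fulton1998, §7.1 Prop. 7.1 (a) and §12.2 Cor. 12.2 (a)]
[cite: VoisinHodgeI2002, §11.1.2 Rem. 11.19] -/
theorem re_poincarePairing_analyticCycleClass_le_smul_wedge_of_isIrreducibleComponent
    (hk₁ : 2 * d₁ + 2 * p₁ = n) (hk₂ : 2 * d₂ + 2 * p₂ = n) (hq : 2 * (q + 1) + 2 * (p₁ + p₂) = n)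
    {Y₁ Y₂ : Set (ComplexTorus Φ)} (hY₁ : HasPureDim 𝓘(ℂ, E) Y₁ d₁) (hY₂ : HasPureDim 𝓘(ℂ, E) Y₂ d₂)
    {C : Set (ComplexTorus Φ)} (hC : IsIrreducibleComponent 𝓘(ℂ, E) (Y₁ ∩ Y₂) C)
    (hCdim : HasPureDim 𝓘(ℂ, E) C (q + 1)) (θ : E [⋀^Fin (2 * (q + 1))]→L[ℝ] ℂ)
    (hθ : ∀ (W : Set (ComplexTorus Φ)), HasPureDim 𝓘(ℂ, E) W (q + 1) →
      0 ≤ (poincarePairing Φ e hq θ (setCycleClass Φ e hq W)).re) :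
    (poincarePairing Φ e hq θ (analyticCycleClass Φ e hq hCdim)).re ≤
      (poincarePairing Φ e hq θ ((orientationSign Φ e : ℂ) •
        ((analyticCycleClass Φ e hk₁ hY₁).wedge (analyticCycleClass Φ e hk₂ hY₂)).domDomCongr
          (finCongr (by ring : 2 * p₁ + 2 * p₂ = 2 * (p₁ + p₂))))).re := by
  have h := sum_re_poincarePairing_setCycleClass_le_smul_wedge_of_proper_components Φ e hk₁ hk₂ hq hY₁ hY₂ {C}
    (fun C' hC' ↦ by rw [Finset.mem_singleton.1 hC']; exact ⟨hC, hCdim⟩) θ hθ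
  rwa [Finset.sum_singleton, setCycleClass_of_hasPureDim Φ e _ hCdim] at h

/-- **`(L^{q+1} · Y₁ · Y₂) ∈ ℕ`**: for a Riemann form `η` (`c₁(L) = ofRealForm(−η)`) the pairing
`⟨c₁(L)^{∧(q+1)}, sign(e) · [Y₁]_e ∧ [Y₂]_e⟩_e` is a natural number — the `L`-degree of the effective intersection
cycle. [cite: Fulton1998, §12.2 Cor. 12.2 (a) and Example 12.2.1 (a)] [cite: deJong1993AmpleLineBundles, Ch. VII §4 Thm. 4.3.1] -/
theorem IsRiemannForm.exists_nat_poincarePairing_wedgePow_smul_wedge_eq (hk₁ : 2 * d₁ + 2 * p₁ = n)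
    (hk₂ : 2 * d₂ + 2 * p₂ = n) (hq : 2 * (q + 1) + 2 * (p₁ + p₂) = n) {Y₁ Y₂ : Set (ComplexTorus Φ)}
    (hY₁ : HasPureDim 𝓘(ℂ, E) Y₁ d₁) (hY₂ : HasPureDim 𝓘(ℂ, E) Y₂ d₂)
    {η : E [⋀^Fin 2]→L[ℝ] ℝ} (hη : IsRiemannForm Φ η) :
    ∃ m : ℕ, poincarePairing Φ e hq (wedgePow (ofRealForm (-η)) (q + 1)) ((orientationSign Φ e : ℂ) •
        ((analyticCycleClass Φ e hk₁ hY₁).wedge (analyticCycleClass Φ e hk₂ hY₂)).domDomCongr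
          (finCongr (by ring : 2 * p₁ + 2 * p₂ = 2 * (p₁ + p₂)))) = m := by
  have hs : ((orientationSign Φ e : ℤ) : ℂ) * orientationSign Φ e = 1 := by
    exact_mod_cast orientationSign_mul_self Φ e
  obtain ⟨S, hS0, -, -, -, -, hcl⟩ :=
    exists_effectiveCycle_wedge_analyticCycleClass_eq_forall_one_le_mult Φ e hk₁ hk₂ hq hY₁ hY₂
  obtain ⟨m, hm, -⟩ := hη.exists_nat_poincarePairing_wedgePow_chainCycleClass_eq Φ e hq hS0
  exact ⟨m, by rw [hcl, smul_smul, hs, one_smul]; exact hm⟩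

/-- **Polarised: `Σ_{C proper} (L^{q+1} · C) ≤ (L^{q+1} · Y₁ · Y₂)`** for every finite set `P` of proper components
of `Y₁ ∩ Y₂` — Fulton's refined Bézout "`Σ_i deg Z_i ≤ ∏_j deg V_j`" (Example 8.4.6) for the proper `Z_i`, on a
polarised complex torus. [cite: Fulton1998, §8.4 Example 8.4.6 and §12.2 Cor. 12.2 (a), Example 12.2.1 (a)]
[cite: deJong1993AmpleLineBundles, Ch. VII §4 Thm. 4.3.1] -/
theorem IsRiemannForm.sum_re_poincarePairing_wedgePow_setCycleClass_le_smul_wedge_of_proper_components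
    (hk₁ : 2 * d₁ + 2 * p₁ = n) (hk₂ : 2 * d₂ + 2 * p₂ = n) (hq : 2 * (q + 1) + 2 * (p₁ + p₂) = n)
    {Y₁ Y₂ : Set (ComplexTorus Φ)} (hY₁ : HasPureDim 𝓘(ℂ, E) Y₁ d₁) (hY₂ : HasPureDim 𝓘(ℂ, E) Y₂ d₂)
    (P : Finset (Set (ComplexTorus Φ)))
    (hP : ∀ C ∈ P, IsIrreducibleComponent 𝓘(ℂ, E) (Y₁ ∩ Y₂) C ∧ HasPureDim 𝓘(ℂ, E) C (q + 1))
    {η : E [⋀^Fin 2]→L[ℝ] ℝ} (hη : IsRiemannForm Φ η) :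
    ∑ C ∈ P, (poincarePairing Φ e hq (wedgePow (ofRealForm (-η)) (q + 1)) (setCycleClass Φ e hq C)).re ≤
      (poincarePairing Φ e hq (wedgePow (ofRealForm (-η)) (q + 1)) ((orientationSign Φ e : ℂ) •
        ((analyticCycleClass Φ e hk₁ hY₁).wedge (analyticCycleClass Φ e hk₂ hY₂)).domDomCongr
          (finCongr (by ring : 2 * p₁ + 2 * p₂ = 2 * (p₁ + p₂))))).re := by
  refine sum_re_poincarePairing_setCycleClass_le_smul_wedge_of_proper_components Φ e hk₁ hk₂ hq hY₁ hY₂ P hP _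
    fun W hW ↦ ?_
  rw [setCycleClass_of_hasPureDim Φ e _ hW]
  exact (hη.re_poincarePairing_wedgePow_analyticCycleClass_pos Φ e _ hW).le

/-- **Polarised, one proper component: `1 ≤ (L^{q+1} · C) ≤ (L^{q+1} · Y₁ · Y₂)`.**
[cite: Fulton1998, §7.1 Prop. 7.1 (a) and §12.2 Cor. 12.2 (a), (b)] [cite: deJong1993AmpleLineBundles, Ch. VII §4 Remarks 4.3 (a) and Thm. 4.3.1] -/
theorem IsRiemannForm.one_le_re_poincarePairing_wedgePow_analyticCycleClass_and_le_smul_wedge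
    (hk₁ : 2 * d₁ + 2 * p₁ = n) (hk₂ : 2 * d₂ + 2 * p₂ = n) (hq : 2 * (q + 1) + 2 * (p₁ + p₂) = n)
    {Y₁ Y₂ : Set (ComplexTorus Φ)} (hY₁ : HasPureDim 𝓘(ℂ, E) Y₁ d₁) (hY₂ : HasPureDim 𝓘(ℂ, E) Y₂ d₂)
    {C : Set (ComplexTorus Φ)} (hC : IsIrreducibleComponent 𝓘(ℂ, E) (Y₁ ∩ Y₂) C)
    (hCdim : HasPureDim 𝓘(ℂ, E) C (q + 1)) {η : E [⋀^Fin 2]→L[ℝ] ℝ} (hη : IsRiemannForm Φ η) :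
    1 ≤ (poincarePairing Φ e hq (wedgePow (ofRealForm (-η)) (q + 1)) (analyticCycleClass Φ e hq hCdim)).re ∧
      (poincarePairing Φ e hq (wedgePow (ofRealForm (-η)) (q + 1)) (analyticCycleClass Φ e hq hCdim)).re ≤
        (poincarePairing Φ e hq (wedgePow (ofRealForm (-η)) (q + 1)) ((orientationSign Φ e : ℂ) •
          ((analyticCycleClass Φ e hk₁ hY₁).wedge (analyticCycleClass Φ e hk₂ hY₂)).domDomCongr
            (finCongr (by ring : 2 * p₁ + 2 * p₂ = 2 * (p₁ + p₂))))).re := by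
  refine ⟨?_, re_poincarePairing_analyticCycleClass_le_smul_wedge_of_isIrreducibleComponent Φ e hk₁ hk₂ hq hY₁
    hY₂ hC hCdim _ fun W hW ↦ ?_⟩
  · rw [poincarePairing_analyticCycleClass]
    exact hη.one_le_re_analyticCyclePeriod_wedgePow Φ hCdim
  · rw [setCycleClass_of_hasPureDim Φ e _ hW]
    exact (hη.re_poincarePairing_wedgePow_analyticCycleClass_pos Φ e _ hW).le

/-- **BÉZOUT AMID EXCESS COMPONENTS: `#{proper components of Y₁ ∩ Y₂} ≤ (L^{q+1} · Y₁ · Y₂)`** on a polarised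
complex torus, for ARBITRARY closed analytic `Y₁, Y₂` of pure dimensions (no properness hypothesis): every
proper component contributes `m_C · (L^{q+1} · C) ≥ 1` to the degree of the effective intersection cycle, the
excess components contribute `≥ 0`. `ComplexTorusAnalyticBezoutInequality` is the case of a proper
intersection. [cite: Fulton1998, §8.4 Example 8.4.6 and §12.2 Cor. 12.2 (a), Example 12.2.1 (a)]
[cite: deJong1993AmpleLineBundles, Ch. VII §4 Remarks 4.3 (a), (c) and Thm. 4.3.1] -/
theorem IsRiemannForm.ncard_properComponent_inter_le_re_poincarePairing_smul_wedge
    (hk₁ : 2 * d₁ + 2 * p₁ = n) (hk₂ : 2 * d₂ + 2 * p₂ = n) (hq : 2 * (q + 1) + 2 * (p₁ + p₂) = n)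
    {Y₁ Y₂ : Set (ComplexTorus Φ)} (hY₁ : HasPureDim 𝓘(ℂ, E) Y₁ d₁) (hY₂ : HasPureDim 𝓘(ℂ, E) Y₂ d₂)
    {η : E [⋀^Fin 2]→L[ℝ] ℝ} (hη : IsRiemannForm Φ η) :
    (({C : Set (ComplexTorus Φ) | IsIrreducibleComponent 𝓘(ℂ, E) (Y₁ ∩ Y₂) C ∧
        HasPureDim 𝓘(ℂ, E) C (q + 1)}.ncard : ℕ) : ℝ) ≤
      (poincarePairing Φ e hq (wedgePow (ofRealForm (-η)) (q + 1)) ((orientationSign Φ e : ℂ) •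
        ((analyticCycleClass Φ e hk₁ hY₁).wedge (analyticCycleClass Φ e hk₂ hY₂)).domDomCongr
          (finCongr (by ring : 2 * p₁ + 2 * p₂ = 2 * (p₁ + p₂))))).re := by
  have hfin := finite_setOf_isIrreducibleComponent_inter_and_hasPureDim Φ (r := q + 1) hY₁ hY₂
  rw [Set.ncard_eq_toFinset_card _ hfin]
  have hP : ∀ C ∈ hfin.toFinset, IsIrreducibleComponent 𝓘(ℂ, E) (Y₁ ∩ Y₂) C ∧ HasPureDim 𝓘(ℂ, E) C (q + 1) :=
    fun C hC ↦ hfin.mem_toFinset.1 hC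
  refine le_trans ?_ (hη.sum_re_poincarePairing_wedgePow_setCycleClass_le_smul_wedge_of_proper_components Φ e
    hk₁ hk₂ hq hY₁ hY₂ _ hP)
  rw [Finset.card_eq_sum_ones, Nat.cast_sum, Nat.cast_one]
  refine Finset.sum_le_sum fun C hC ↦ ?_
  rw [poincarePairing_setCycleClass Φ e _ (hP C hC).2]
  exact hη.one_le_re_analyticCyclePeriod_wedgePow Φ (hP C hC).2

/-- **If `(L^{q+1} · Y₁ · Y₂) = m ∈ ℕ` then `Y₁ ∩ Y₂` has at most `m` proper components.**
[cite: Fulton1998, §8.4 Example 8.4.6 and §12.2 Cor. 12.2 (a)] [cite: deJong1993AmpleLineBundles, Ch. VII §4 Thm. 4.3.1] -/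
theorem IsRiemannForm.ncard_properComponent_inter_le_of_poincarePairing_eq_natCast
    (hk₁ : 2 * d₁ + 2 * p₁ = n) (hk₂ : 2 * d₂ + 2 * p₂ = n) (hq : 2 * (q + 1) + 2 * (p₁ + p₂) = n)
    {Y₁ Y₂ : Set (ComplexTorus Φ)} (hY₁ : HasPureDim 𝓘(ℂ, E) Y₁ d₁) (hY₂ : HasPureDim 𝓘(ℂ, E) Y₂ d₂)
    {η : E [⋀^Fin 2]→L[ℝ] ℝ} (hη : IsRiemannForm Φ η) {m : ℕ}
    (hm : poincarePairing Φ e hq (wedgePow (ofRealForm (-η)) (q + 1)) ((orientationSign Φ e : ℂ) •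
        ((analyticCycleClass Φ e hk₁ hY₁).wedge (analyticCycleClass Φ e hk₂ hY₂)).domDomCongr
          (finCongr (by ring : 2 * p₁ + 2 * p₂ = 2 * (p₁ + p₂)))) = m) :
    {C : Set (ComplexTorus Φ) | IsIrreducibleComponent 𝓘(ℂ, E) (Y₁ ∩ Y₂) C ∧
      HasPureDim 𝓘(ℂ, E) C (q + 1)}.ncard ≤ m := by
  have h := hη.ncard_properComponent_inter_le_re_poincarePairing_smul_wedge Φ e hk₁ hk₂ hq hY₁ hY₂
  rw [hm, Complex.natCast_re] at h
  exact_mod_cast h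

/-- **There is `m = (L^{q+1} · Y₁ · Y₂) ∈ ℕ` with `#{proper components of Y₁ ∩ Y₂} ≤ m`.**
[cite: Fulton1998, §8.4 Example 8.4.6 and §12.2 Cor. 12.2 (a)] [cite: deJong1993AmpleLineBundles, Ch. VII §4 Thm. 4.3.1] -/
theorem IsRiemannForm.exists_nat_poincarePairing_smul_wedge_eq_and_ncard_properComponent_inter_le
    (hk₁ : 2 * d₁ + 2 * p₁ = n) (hk₂ : 2 * d₂ + 2 * p₂ = n) (hq : 2 * (q + 1) + 2 * (p₁ + p₂) = n)
    {Y₁ Y₂ : Set (ComplexTorus Φ)} (hY₁ : HasPureDim 𝓘(ℂ, E) Y₁ d₁) (hY₂ : HasPureDim 𝓘(ℂ, E) Y₂ d₂)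
    {η : E [⋀^Fin 2]→L[ℝ] ℝ} (hη : IsRiemannForm Φ η) :
    ∃ m : ℕ, poincarePairing Φ e hq (wedgePow (ofRealForm (-η)) (q + 1)) ((orientationSign Φ e : ℂ) •
        ((analyticCycleClass Φ e hk₁ hY₁).wedge (analyticCycleClass Φ e hk₂ hY₂)).domDomCongr
          (finCongr (by ring : 2 * p₁ + 2 * p₂ = 2 * (p₁ + p₂)))) = m ∧
      {C : Set (ComplexTorus Φ) | IsIrreducibleComponent 𝓘(ℂ, E) (Y₁ ∩ Y₂) C ∧
        HasPureDim 𝓘(ℂ, E) C (q + 1)}.ncard ≤ m := by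
  obtain ⟨m, hm⟩ := hη.exists_nat_poincarePairing_wedgePow_smul_wedge_eq Φ e hk₁ hk₂ hq hY₁ hY₂
  exact ⟨m, hm, hη.ncard_properComponent_inter_le_of_poincarePairing_eq_natCast Φ e hk₁ hk₂ hq hY₁ hY₂ hm⟩

/-! ### §3 Equality in Bézout for two subvarieties -/

/-- **EQUALITY IN BÉZOUT for `Y₁ ∩ Y₂` (amid excess components).** If the finite set `P` lists the proper
components of `Y₁ ∩ Y₂` and `(L^{q+1} · Y₁ · Y₂) ≤ #P`, then there is an effective `(q+1)`-cycle `S` on `Y₁ ∩ Y₂`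
with `[Y₁]_e ∧ [Y₂]_e = sign(e) · cl_e(S)` whose components are EXACTLY the members of `P`, each of multiplicity `1`
and `L`-degree `1`; `|S| = ⋃_{C ∈ P} C`, `sign(e) · [Y₁] ∧ [Y₂] = Σ_{C ∈ P} [C]` and `(L^{q+1} · Y₁ · Y₂) = #P`. (From
`#P ≤ #components(S) ≤ Σ_W m_W deg_L W = (L^{q+1} · Y₁ · Y₂) ≤ #P`.) [cite: Fulton1998, §8.2 Prop. 8.2 (a), (c), §8.4 (1) and Example 8.4.6]
[cite: deJong1993AmpleLineBundles, Ch. VII §4 Remarks 4.3 (a), (c) and Thm. 4.3.1] -/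
theorem IsRiemannForm.exists_effectiveCycle_inter_of_re_poincarePairing_le_card_properComponents
    (hk₁ : 2 * d₁ + 2 * p₁ = n) (hk₂ : 2 * d₂ + 2 * p₂ = n) (hq : 2 * (q + 1) + 2 * (p₁ + p₂) = n)
    {Y₁ Y₂ : Set (ComplexTorus Φ)} (hY₁ : HasPureDim 𝓘(ℂ, E) Y₁ d₁) (hY₂ : HasPureDim 𝓘(ℂ, E) Y₂ d₂)
    (P : Finset (Set (ComplexTorus Φ)))
    (hP : ∀ C, C ∈ P ↔ IsIrreducibleComponent 𝓘(ℂ, E) (Y₁ ∩ Y₂) C ∧ HasPureDim 𝓘(ℂ, E) C (q + 1))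
    {η : E [⋀^Fin 2]→L[ℝ] ℝ} (hη : IsRiemannForm Φ η)
    (hle : (poincarePairing Φ e hq (wedgePow (ofRealForm (-η)) (q + 1)) ((orientationSign Φ e : ℂ) •
        ((analyticCycleClass Φ e hk₁ hY₁).wedge (analyticCycleClass Φ e hk₂ hY₂)).domDomCongr
          (finCongr (by ring : 2 * p₁ + 2 * p₂ = 2 * (p₁ + p₂))))).re ≤ P.card) :
    ∃ S : HolomorphicChain 𝓘(ℂ, E) (ComplexTorus Φ) (q + 1), (∀ W, 0 ≤ S.mult W) ∧ S.support ⊆ Y₁ ∩ Y₂ ∧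
      (∀ W, S.mult W ≠ 0 ↔ W ∈ P) ∧ (∀ C ∈ P, S.mult C = 1) ∧
      (∀ C ∈ P, poincarePairing Φ e hq (wedgePow (ofRealForm (-η)) (q + 1)) (setCycleClass Φ e hq C) = 1) ∧
      S.support = ⋃ C ∈ P, C ∧
      ((analyticCycleClass Φ e hk₁ hY₁).wedge (analyticCycleClass Φ e hk₂ hY₂)).domDomCongr
          (finCongr (by ring : 2 * p₁ + 2 * p₂ = 2 * (p₁ + p₂))) = (orientationSign Φ e : ℂ) • chainCycleClass Φ e hq S ∧
      (orientationSign Φ e : ℂ) • ((analyticCycleClass Φ e hk₁ hY₁).wedge (analyticCycleClass Φ e hk₂ hY₂)).domDomCongr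
          (finCongr (by ring : 2 * p₁ + 2 * p₂ = 2 * (p₁ + p₂))) = ∑ C ∈ P, setCycleClass Φ e hq C ∧
      poincarePairing Φ e hq (wedgePow (ofRealForm (-η)) (q + 1)) ((orientationSign Φ e : ℂ) •
        ((analyticCycleClass Φ e hk₁ hY₁).wedge (analyticCycleClass Φ e hk₂ hY₂)).domDomCongr
          (finCongr (by ring : 2 * p₁ + 2 * p₂ = 2 * (p₁ + p₂)))) = P.card := by
  classical
  have hs : ((orientationSign Φ e : ℤ) : ℂ) * orientationSign Φ e = 1 := by
    exact_mod_cast orientationSign_mul_self Φ e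
  obtain ⟨S, hS0, hSs, -, -, hprop, hcl⟩ :=
    exists_effectiveCycle_wedge_analyticCycleClass_eq_forall_one_le_mult Φ e hk₁ hk₂ hq hY₁ hY₂
  -- `sign(e) · [Y₁] ∧ [Y₂] = cl(S)`
  have hcl' : (orientationSign Φ e : ℂ) • ((analyticCycleClass Φ e hk₁ hY₁).wedge
      (analyticCycleClass Φ e hk₂ hY₂)).domDomCongr (finCongr (by ring : 2 * p₁ + 2 * p₂ = 2 * (p₁ + p₂))) =
        chainCycleClass Φ e hq S := by
    rw [hcl, smul_smul, hs, one_smul]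
  set θ : E [⋀^Fin (2 * (q + 1))]→L[ℝ] ℂ := wedgePow (ofRealForm (-η)) (q + 1) with hθ
  set F := S.finite_components_of_compactSpace.toFinset with hF
  have hFmem : ∀ W, W ∈ F ↔ S.mult W ≠ 0 := fun W ↦ by
    rw [hF, Set.Finite.mem_toFinset, HolomorphicChain.mem_components_iff]
  have hPF : P ⊆ F := fun C hC ↦ by
    rw [hFmem]
    have h1 := (hprop C ((hP C).1 hC).1 ((hP C).1 hC).2).2
    omega
  have hmult : ∀ W ∈ F, (1 : ℝ) ≤ ((S.mult W : ℤ) : ℝ) := fun W hW ↦ by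
    have h0 := hS0 W
    have hW0 := (hFmem W).1 hW
    exact_mod_cast (show (1 : ℤ) ≤ S.mult W by omega)
  have hdeg : ∀ W ∈ F, 1 ≤ (poincarePairing Φ e hq θ (setCycleClass Φ e hq W)).re := fun W hW ↦ by
    rw [poincarePairing_setCycleClass Φ e hq (S.hasPureDim_of_mult_ne_zero ((hFmem W).1 hW))]
    exact hη.one_le_re_analyticCyclePeriod_wedgePow Φ _
  have hsum : (poincarePairing Φ e hq θ (chainCycleClass Φ e hq S)).re =
      ∑ W ∈ F, ((S.mult W : ℤ) : ℝ) * (poincarePairing Φ e hq θ (setCycleClass Φ e hq W)).re := by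
    rw [poincarePairing_chainCycleClass, Complex.re_sum]
    refine Finset.sum_congr rfl fun W _ ↦ ?_
    rw [← Complex.ofReal_intCast, Complex.re_ofReal_mul]
  have hle' : (poincarePairing Φ e hq θ (chainCycleClass Φ e hq S)).re ≤ P.card := by rw [← hcl']; exact hle
  have hterm : ∀ W ∈ F, (1 : ℝ) ≤ ((S.mult W : ℤ) : ℝ) * (poincarePairing Φ e hq θ (setCycleClass Φ e hq W)).re :=
    fun W hW ↦ by nlinarith [hmult W hW, hdeg W hW]
  have hFcard : (F.card : ℝ) ≤
      ∑ W ∈ F, ((S.mult W : ℤ) : ℝ) * (poincarePairing Φ e hq θ (setCycleClass Φ e hq W)).re := by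
    rw [Finset.card_eq_sum_ones, Nat.cast_sum, Nat.cast_one]
    exact Finset.sum_le_sum hterm
  have hFP : F = P := by
    symm
    refine Finset.eq_of_subset_of_card_le hPF ?_
    have h : (F.card : ℝ) ≤ P.card := hFcard.trans (hsum ▸ hle')
    exact_mod_cast h
  have hterm1 : ∀ W ∈ F, ((S.mult W : ℤ) : ℝ) * (poincarePairing Φ e hq θ (setCycleClass Φ e hq W)).re = 1 := by
    have hsumle : ∑ W ∈ F, ((S.mult W : ℤ) : ℝ) * (poincarePairing Φ e hq θ (setCycleClass Φ e hq W)).re ≤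
        ∑ W ∈ F, (1 : ℝ) := by
      rw [Finset.sum_const, nsmul_eq_mul, mul_one, ← hsum, hFP]
      exact hle'
    have heq : ∑ W ∈ F, (1 : ℝ) =
        ∑ W ∈ F, ((S.mult W : ℤ) : ℝ) * (poincarePairing Φ e hq θ (setCycleClass Φ e hq W)).re :=
      le_antisymm (Finset.sum_le_sum hterm) hsumle
    intro W hW
    exact ((Finset.sum_eq_sum_iff_of_le hterm).1 heq W hW).symm
  have hmult1 : ∀ W ∈ F, S.mult W = 1 := fun W hW ↦ by
    have hm := hmult W hW
    have hd := hdeg W hW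
    have h1 := hterm1 W hW
    have hm1 : ((S.mult W : ℤ) : ℝ) = 1 := by
      nlinarith [mul_nonneg (sub_nonneg.2 hm) (sub_nonneg.2 hd)]
    exact_mod_cast hm1
  have hdeg1 : ∀ W ∈ F, poincarePairing Φ e hq θ (setCycleClass Φ e hq W) = 1 := fun W hW ↦ by
    have hm := hmult W hW
    have hd := hdeg W hW
    have h1 := hterm1 W hW
    have hd1 : (poincarePairing Φ e hq θ (setCycleClass Φ e hq W)).re = 1 := by
      nlinarith [mul_nonneg (sub_nonneg.2 hm) (sub_nonneg.2 hd)]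
    have hWd := S.hasPureDim_of_mult_ne_zero ((hFmem W).1 hW)
    obtain ⟨mW, -, hmW⟩ := IsRiemannForm.exists_pos_analyticCyclePeriod_wedgeFamily_eq Φ hWd fun _ : Fin (q + 1) ↦ hη
    rw [poincarePairing_setCycleClass Φ e hq hWd] at hd1 ⊢
    rw [hθ] at hd1 ⊢
    change analyticCyclePeriod Φ hWd (wedgeFamily (q + 1) fun _ ↦ ofRealForm (-η)) = 1
    change (analyticCyclePeriod Φ hWd (wedgeFamily (q + 1) fun _ ↦ ofRealForm (-η))).re = 1 at hd1
    rw [hmW, Complex.natCast_re] at hd1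
    rw [hmW]
    exact_mod_cast hd1
  have hsum_cl : chainCycleClass Φ e hq S = ∑ C ∈ P, setCycleClass Φ e hq C := by
    rw [chainCycleClass, ← hF, hFP]
    refine Finset.sum_congr rfl fun C hC ↦ ?_
    rw [hmult1 C (hPF hC), one_zsmul]
  refine ⟨S, hS0, hSs, fun W ↦ by rw [← hFmem, hFP], fun C hC ↦ hmult1 C (hPF hC),
    fun C hC ↦ hdeg1 C (hPF hC), ?_, hcl, by rw [hcl', hsum_cl], ?_⟩
  · rw [HolomorphicChain.support_eq_biUnion_toFinset, ← hF, hFP]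
  · rw [hcl', hsum_cl, map_sum, Finset.sum_congr rfl fun C hC ↦ hdeg1 C (hPF hC), Finset.sum_const, nsmul_eq_mul,
      mul_one]

/-- **Equality in Bézout ⇒ `sign(e) · [Y₁] ∧ [Y₂] = Σ_{C proper} [C]`** (multiplicity one, no excess contribution).
[cite: Fulton1998, §8.4 (1) and Example 8.4.6, §12.2 Cor. 12.2 (a)] [cite: deJong1993AmpleLineBundles, Ch. VII §4 Thm. 4.3.1] -/
theorem IsRiemannForm.smul_wedge_eq_sum_setCycleClass_of_re_poincarePairing_le_card
    (hk₁ : 2 * d₁ + 2 * p₁ = n) (hk₂ : 2 * d₂ + 2 * p₂ = n) (hq : 2 * (q + 1) + 2 * (p₁ + p₂) = n)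
    {Y₁ Y₂ : Set (ComplexTorus Φ)} (hY₁ : HasPureDim 𝓘(ℂ, E) Y₁ d₁) (hY₂ : HasPureDim 𝓘(ℂ, E) Y₂ d₂)
    (P : Finset (Set (ComplexTorus Φ)))
    (hP : ∀ C, C ∈ P ↔ IsIrreducibleComponent 𝓘(ℂ, E) (Y₁ ∩ Y₂) C ∧ HasPureDim 𝓘(ℂ, E) C (q + 1))
    {η : E [⋀^Fin 2]→L[ℝ] ℝ} (hη : IsRiemannForm Φ η)
    (hle : (poincarePairing Φ e hq (wedgePow (ofRealForm (-η)) (q + 1)) ((orientationSign Φ e : ℂ) •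
        ((analyticCycleClass Φ e hk₁ hY₁).wedge (analyticCycleClass Φ e hk₂ hY₂)).domDomCongr
          (finCongr (by ring : 2 * p₁ + 2 * p₂ = 2 * (p₁ + p₂))))).re ≤ P.card) :
    (orientationSign Φ e : ℂ) • ((analyticCycleClass Φ e hk₁ hY₁).wedge (analyticCycleClass Φ e hk₂ hY₂)).domDomCongr
        (finCongr (by ring : 2 * p₁ + 2 * p₂ = 2 * (p₁ + p₂))) = ∑ C ∈ P, setCycleClass Φ e hq C ∧
      poincarePairing Φ e hq (wedgePow (ofRealForm (-η)) (q + 1)) ((orientationSign Φ e : ℂ) •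
        ((analyticCycleClass Φ e hk₁ hY₁).wedge (analyticCycleClass Φ e hk₂ hY₂)).domDomCongr
          (finCongr (by ring : 2 * p₁ + 2 * p₂ = 2 * (p₁ + p₂)))) = P.card := by
  obtain ⟨-, -, -, -, -, -, -, -, hcl, hcard⟩ :=
    hη.exists_effectiveCycle_inter_of_re_poincarePairing_le_card_properComponents Φ e hk₁ hk₂ hq hY₁ hY₂ P hP hle
  exact ⟨hcl, hcard⟩

/-- **Equality in Bézout ⇒ every proper component of `Y₁ ∩ Y₂` has `L`-degree one.**
[cite: Fulton1998, §8.4 (1) and Example 8.4.6] [cite: deJong1993AmpleLineBundles, Ch. VII §4 Remarks 4.3 (a) and Thm. 4.3.1] -/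
theorem IsRiemannForm.poincarePairing_wedgePow_analyticCycleClass_eq_one_of_re_poincarePairing_smul_wedge_le_card
    (hk₁ : 2 * d₁ + 2 * p₁ = n) (hk₂ : 2 * d₂ + 2 * p₂ = n) (hq : 2 * (q + 1) + 2 * (p₁ + p₂) = n)
    {Y₁ Y₂ : Set (ComplexTorus Φ)} (hY₁ : HasPureDim 𝓘(ℂ, E) Y₁ d₁) (hY₂ : HasPureDim 𝓘(ℂ, E) Y₂ d₂)
    (P : Finset (Set (ComplexTorus Φ)))
    (hP : ∀ C, C ∈ P ↔ IsIrreducibleComponent 𝓘(ℂ, E) (Y₁ ∩ Y₂) C ∧ HasPureDim 𝓘(ℂ, E) C (q + 1))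
    {η : E [⋀^Fin 2]→L[ℝ] ℝ} (hη : IsRiemannForm Φ η)
    (hle : (poincarePairing Φ e hq (wedgePow (ofRealForm (-η)) (q + 1)) ((orientationSign Φ e : ℂ) •
        ((analyticCycleClass Φ e hk₁ hY₁).wedge (analyticCycleClass Φ e hk₂ hY₂)).domDomCongr
          (finCongr (by ring : 2 * p₁ + 2 * p₂ = 2 * (p₁ + p₂))))).re ≤ P.card)
    {C : Set (ComplexTorus Φ)} (hC : C ∈ P) :
    poincarePairing Φ e hq (wedgePow (ofRealForm (-η)) (q + 1)) (analyticCycleClass Φ e hq ((hP C).1 hC).2) = 1 := by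
  obtain ⟨-, -, -, -, -, hdeg, -⟩ :=
    hη.exists_effectiveCycle_inter_of_re_poincarePairing_le_card_properComponents Φ e hk₁ hk₂ hq hY₁ hY₂ P hP hle
  rw [← setCycleClass_of_hasPureDim Φ e _ ((hP C).1 hC).2]
  exact hdeg C hC

/-- **MULTIPLICITY ONE FROM EQUALITY IN BÉZOUT (proper intersection of two subvarieties).** If `Y₁ ∩ Y₂` is
proper (of pure dimension `q + 1`), its irreducible components listed by `P`, and `(L^{q+1} · Y₁ · Y₂) ≤ #P`
(hence `= #P`, `ComplexTorusAnalyticBezoutInequality`), then `sign(e) · [Y₁]_e ∧ [Y₂]_e = [Y₁ ∩ Y₂]_e` — all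
intersection multiplicities `i(C) = 1` — every component has `L`-degree one, and `(L^{q+1} · Y₁ · Y₂) = #P`.
[cite: Fulton1998, §8.2 Prop. 8.2 (a), (c), §8.4 (1) and Example 8.4.6] [cite: deJong1993AmpleLineBundles, Ch. VII §4 Remarks 4.3 (a), (c) and Thm. 4.3.1] -/
theorem IsRiemannForm.smul_wedge_eq_analyticCycleClass_inter_of_re_poincarePairing_le_card
    (hk₁ : 2 * d₁ + 2 * p₁ = n) (hk₂ : 2 * d₂ + 2 * p₂ = n) (hq : 2 * (q + 1) + 2 * (p₁ + p₂) = n)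
    {Y₁ Y₂ : Set (ComplexTorus Φ)} (hY₁ : HasPureDim 𝓘(ℂ, E) Y₁ d₁) (hY₂ : HasPureDim 𝓘(ℂ, E) Y₂ d₂)
    (hI : HasPureDim 𝓘(ℂ, E) (Y₁ ∩ Y₂) (q + 1)) (P : Finset (Set (ComplexTorus Φ)))
    (hP : ∀ C, C ∈ P ↔ IsIrreducibleComponent 𝓘(ℂ, E) (Y₁ ∩ Y₂) C)
    {η : E [⋀^Fin 2]→L[ℝ] ℝ} (hη : IsRiemannForm Φ η)
    (hle : (poincarePairing Φ e hq (wedgePow (ofRealForm (-η)) (q + 1)) ((orientationSign Φ e : ℂ) •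
        ((analyticCycleClass Φ e hk₁ hY₁).wedge (analyticCycleClass Φ e hk₂ hY₂)).domDomCongr
          (finCongr (by ring : 2 * p₁ + 2 * p₂ = 2 * (p₁ + p₂))))).re ≤ P.card) :
    (orientationSign Φ e : ℂ) • ((analyticCycleClass Φ e hk₁ hY₁).wedge (analyticCycleClass Φ e hk₂ hY₂)).domDomCongr
        (finCongr (by ring : 2 * p₁ + 2 * p₂ = 2 * (p₁ + p₂))) = analyticCycleClass Φ e hq hI ∧
      (∀ C ∈ P, poincarePairing Φ e hq (wedgePow (ofRealForm (-η)) (q + 1)) (setCycleClass Φ e hq C) = 1) ∧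
      poincarePairing Φ e hq (wedgePow (ofRealForm (-η)) (q + 1)) ((orientationSign Φ e : ℂ) •
        ((analyticCycleClass Φ e hk₁ hY₁).wedge (analyticCycleClass Φ e hk₂ hY₂)).domDomCongr
          (finCongr (by ring : 2 * p₁ + 2 * p₂ = 2 * (p₁ + p₂)))) = P.card := by
  have hP' : ∀ C, C ∈ P ↔ IsIrreducibleComponent 𝓘(ℂ, E) (Y₁ ∩ Y₂) C ∧ HasPureDim 𝓘(ℂ, E) C (q + 1) := fun C ↦
    (hP C).trans ⟨fun hC ↦ ⟨hC, hC.hasPureDim hI⟩, fun h ↦ h.1⟩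
  obtain ⟨-, -, -, -, -, hdeg, -, -, hcl, hcard⟩ :=
    hη.exists_effectiveCycle_inter_of_re_poincarePairing_le_card_properComponents Φ e hk₁ hk₂ hq hY₁ hY₂ P hP' hle
  refine ⟨?_, hdeg, hcard⟩
  rw [hcl, analyticCycleClass_eq_sum_setCycleClass_of_forall_iff Φ e hq hI P hP]

/-- **`Set.ncard` form for a proper intersection: `(L^{q+1} · Y₁ · Y₂) ≤ #{components of Y₁ ∩ Y₂}` forces
`sign(e) · [Y₁] ∧ [Y₂] = [Y₁ ∩ Y₂]` and `(L^{q+1} · Y₁ · Y₂) = #{components}`.** [cite: Fulton1998, §8.2 Prop. 8.2 (c), §8.4 (1) and Example 8.4.6]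
[cite: deJong1993AmpleLineBundles, Ch. VII §4 Thm. 4.3.1] -/
theorem IsRiemannForm.smul_wedge_eq_analyticCycleClass_inter_of_re_poincarePairing_le_ncard
    (hk₁ : 2 * d₁ + 2 * p₁ = n) (hk₂ : 2 * d₂ + 2 * p₂ = n) (hq : 2 * (q + 1) + 2 * (p₁ + p₂) = n)
    {Y₁ Y₂ : Set (ComplexTorus Φ)} (hY₁ : HasPureDim 𝓘(ℂ, E) Y₁ d₁) (hY₂ : HasPureDim 𝓘(ℂ, E) Y₂ d₂)
    (hI : HasPureDim 𝓘(ℂ, E) (Y₁ ∩ Y₂) (q + 1)) {η : E [⋀^Fin 2]→L[ℝ] ℝ} (hη : IsRiemannForm Φ η)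
    (hle : (poincarePairing Φ e hq (wedgePow (ofRealForm (-η)) (q + 1)) ((orientationSign Φ e : ℂ) •
        ((analyticCycleClass Φ e hk₁ hY₁).wedge (analyticCycleClass Φ e hk₂ hY₂)).domDomCongr
          (finCongr (by ring : 2 * p₁ + 2 * p₂ = 2 * (p₁ + p₂))))).re ≤
      {C : Set (ComplexTorus Φ) | IsIrreducibleComponent 𝓘(ℂ, E) (Y₁ ∩ Y₂) C}.ncard) :
    (orientationSign Φ e : ℂ) • ((analyticCycleClass Φ e hk₁ hY₁).wedge (analyticCycleClass Φ e hk₂ hY₂)).domDomCongr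
        (finCongr (by ring : 2 * p₁ + 2 * p₂ = 2 * (p₁ + p₂))) = analyticCycleClass Φ e hq hI ∧
      poincarePairing Φ e hq (wedgePow (ofRealForm (-η)) (q + 1)) ((orientationSign Φ e : ℂ) •
        ((analyticCycleClass Φ e hk₁ hY₁).wedge (analyticCycleClass Φ e hk₂ hY₂)).domDomCongr
          (finCongr (by ring : 2 * p₁ + 2 * p₂ = 2 * (p₁ + p₂)))) =
        ({C : Set (ComplexTorus Φ) | IsIrreducibleComponent 𝓘(ℂ, E) (Y₁ ∩ Y₂) C}.ncard : ℕ) := by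
  have hfin := finite_isIrreducibleComponent Φ hI.isAnalyticSet
  rw [Set.ncard_eq_toFinset_card _ hfin] at hle ⊢
  obtain ⟨hcl, -, hcard⟩ := hη.smul_wedge_eq_analyticCycleClass_inter_of_re_poincarePairing_le_card Φ e hk₁ hk₂ hq
    hY₁ hY₂ hI hfin.toFinset (fun C ↦ hfin.mem_toFinset) hle
  exact ⟨hcl, hcard⟩

/-- **Amid excess components, `Set.ncard` form**: `(L^{q+1} · Y₁ · Y₂) ≤ #{proper components of Y₁ ∩ Y₂}` forces
`sign(e) · [Y₁] ∧ [Y₂] = Σ_{C proper} [C]` and `(L^{q+1} · Y₁ · Y₂) = #{proper components}`.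
[cite: Fulton1998, §8.4 (1) and Example 8.4.6, §12.2 Cor. 12.2 (a)] [cite: deJong1993AmpleLineBundles, Ch. VII §4 Thm. 4.3.1] -/
theorem IsRiemannForm.smul_wedge_eq_sum_setCycleClass_of_re_poincarePairing_le_ncard
    (hk₁ : 2 * d₁ + 2 * p₁ = n) (hk₂ : 2 * d₂ + 2 * p₂ = n) (hq : 2 * (q + 1) + 2 * (p₁ + p₂) = n)
    {Y₁ Y₂ : Set (ComplexTorus Φ)} (hY₁ : HasPureDim 𝓘(ℂ, E) Y₁ d₁) (hY₂ : HasPureDim 𝓘(ℂ, E) Y₂ d₂)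
    {η : E [⋀^Fin 2]→L[ℝ] ℝ} (hη : IsRiemannForm Φ η)
    (hle : (poincarePairing Φ e hq (wedgePow (ofRealForm (-η)) (q + 1)) ((orientationSign Φ e : ℂ) •
        ((analyticCycleClass Φ e hk₁ hY₁).wedge (analyticCycleClass Φ e hk₂ hY₂)).domDomCongr
          (finCongr (by ring : 2 * p₁ + 2 * p₂ = 2 * (p₁ + p₂))))).re ≤
      {C : Set (ComplexTorus Φ) | IsIrreducibleComponent 𝓘(ℂ, E) (Y₁ ∩ Y₂) C ∧
        HasPureDim 𝓘(ℂ, E) C (q + 1)}.ncard) :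
    (orientationSign Φ e : ℂ) • ((analyticCycleClass Φ e hk₁ hY₁).wedge (analyticCycleClass Φ e hk₂ hY₂)).domDomCongr
        (finCongr (by ring : 2 * p₁ + 2 * p₂ = 2 * (p₁ + p₂))) =
        ∑ C ∈ (finite_setOf_isIrreducibleComponent_inter_and_hasPureDim Φ (r := q + 1) hY₁ hY₂).toFinset,
          setCycleClass Φ e hq C ∧
      poincarePairing Φ e hq (wedgePow (ofRealForm (-η)) (q + 1)) ((orientationSign Φ e : ℂ) •
        ((analyticCycleClass Φ e hk₁ hY₁).wedge (analyticCycleClass Φ e hk₂ hY₂)).domDomCongr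
          (finCongr (by ring : 2 * p₁ + 2 * p₂ = 2 * (p₁ + p₂)))) =
        ({C : Set (ComplexTorus Φ) | IsIrreducibleComponent 𝓘(ℂ, E) (Y₁ ∩ Y₂) C ∧
          HasPureDim 𝓘(ℂ, E) C (q + 1)}.ncard : ℕ) := by
  have hfin := finite_setOf_isIrreducibleComponent_inter_and_hasPureDim Φ (r := q + 1) hY₁ hY₂
  rw [Set.ncard_eq_toFinset_card _ hfin] at hle ⊢
  exact hη.smul_wedge_eq_sum_setCycleClass_of_re_poincarePairing_le_card Φ e hk₁ hk₂ hq hY₁ hY₂ hfin.toFinset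
    (fun C ↦ hfin.mem_toFinset) hle

end ComplexTorus

end Literature.Geometry.Kaehler

end
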